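import Literature.Probability.RandomPlanarGeometry.HexSAWPolygonCellsOmegaPorts
import HarnessLib

/-!
# Cell calculus for honeycomb polygon surgery, XLII: CASE 2 of THEOREM I read off the image — the five base shapes at the top hexagon, and the decoder

Topic `Literature/Probability/RandomPlanarGeometry` (lane «pcv-sawmu», a-p4 g23; sequel of XLI `…OmegaPorts` (`base_shapes`, `omegaImage_eq_of_case2`,
`disjoint_baseImage_sdiff_of_case2`, `isHost_ll_of_case2`, `lt_top_of_case2`)).

CASE 2 of THEOREM I (THEOREM-OMEGA-g21 §4): the top hexagon `w` of `W = ι S` lies in the base image `C(B)`, `B = peel S`.  By XLI all rays are identity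
rays, `W = C(B) ∪ (S \ B)` disjointly, and every peeled hexagon is `UR` of a host of `B`.  Here, shape by shape (class X, class R, 3-chain, RU flip, RU leaf),
we compute from `W` and `w` alone: the contact count of `w` in `W` (THICK `≥ 2` for X / R / RU-flip, a LEAF for the 3-chain and the RU leaf), the
discriminators `LR w ∈ W` (X, RU-flip: yes; R: no) and `#W = 4` (3-chain: yes; RU leaf: no), and `S` itself as an explicit function of `(W, w)`:
`W − w` (X, RU-flip), `W` minus the roof run left of `w` (R; its length read as the `L`-run of `W` at `w`), the 3-chain below `w`, and `W − w` minus the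
roof between `t₀` and `a_k` (RU leaf; `t₀` read by the `R²`-walk from `c_j = LR w`, `k` by the `R`-run from `t₀`).  This file: the run-length readers
`lrunLen` / `rrunLen` / `walkIdx`, ★ the decoder `decode W w`, the host test `notMem_sdiff_of_case2`, and the profiles of the THICK shapes
(`profile_insert_of_case2` for X and the RU flip, `profile_roof_of_case2` for R).  The leaf shapes and the assembly `S = decode (ι S) w` follow in
XLIII `…OmegaReadings`.

Sources: N. Madras, G. Slade, *The Self-Avoiding Walk* (1993), §3.2, proof of Theorem 3.2.3 pp. 64–65 [MadrasSlade1993]; I. Jensen, J. Phys.: Conf. Ser.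
42 (2006) 163, §2 [Jensen2006HoneycombPolygons].  Label (lane): LANE INFRASTRUCTURE for the lane's step-two injection (THEOREM I, CASE 2 readings);
nothing new in writing.
-/

open Finset

namespace Literature.Probability.RandomPlanarGeometry.SAW

namespace HexCell

/-! ### Iterates of `L` and `R`; three run lengths read off a set -/

/-- `L^[n] c = (c.x − 2n, c.y)`. [cite: Jensen2006HoneycombPolygons, §2] -/
theorem iterate_L (c : Cell) (n : ℕ) : L^[n] c = (c.1 - 2 * (n : ℤ), c.2) := by
  induction n with
  | zero => simp
  | succ n ih => rw [Function.iterate_succ_apply', ih]; ext <;> simp; ring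

/-- `R^[n] c = (c.x + 2n, c.y)`. [cite: Jensen2006HoneycombPolygons, §2] -/
theorem iterate_R (c : Cell) (n : ℕ) : R^[n] c = (c.1 + 2 * (n : ℤ), c.2) := by
  induction n with
  | zero => simp
  | succ n ih => rw [Function.iterate_succ_apply', ih]; ext <;> simp; ring

/-- A finite set of hexagons misses some value of an injective sequence. [cite: MadrasSlade1993, §3.2 (proof of Theorem 3.2.3)] -/
theorem exists_notMem_of_injective (W : Finset Cell) {f : ℕ → Cell} (hf : Function.Injective f) : ∃ n : ℕ, f n ∉ W := by
  by_contra h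
  push Not at h
  exact (Set.infinite_range_of_injective hf).not_finite ((W.finite_toSet).subset (by rintro _ ⟨n, rfl⟩; exact h n))

/-- A finite set cannot contain the whole `L`-orbit of a hexagon. [cite: MadrasSlade1993, §3.2 (proof of Theorem 3.2.3)] -/
theorem exists_iterate_L_notMem (W : Finset Cell) (c : Cell) : ∃ n : ℕ, L^[n] c ∉ W :=
  exists_notMem_of_injective W fun a b hab => by
    have := congrArg Prod.fst hab; simp only [iterate_L] at this; omega

/-- A finite set cannot contain the whole `R`-orbit of a hexagon. [cite: MadrasSlade1993, §3.2 (proof of Theorem 3.2.3)] -/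
theorem exists_iterate_R_notMem (W : Finset Cell) (c : Cell) : ∃ n : ℕ, R^[n + 1] c ∉ W :=
  exists_notMem_of_injective W (f := fun n => R^[n + 1] c) fun a b hab => by
    have := congrArg Prod.fst hab; simp only [iterate_R] at this; push_cast at this; omega

/-- The `R²`-walk inside a finite set stops. [cite: MadrasSlade1993, §3.2 (proof of Theorem 3.2.3)] -/
theorem exists_walkStop (W : Finset Cell) (c : Cell) : ∃ n : ℕ, R (R^[2 * n] c) ∈ W ∨ R^[2 * n + 2] c ∉ W := by
  obtain ⟨n, hn⟩ := exists_notMem_of_injective W (f := fun n => R^[2 * n + 2] c) fun a b hab => by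
    have := congrArg Prod.fst hab; simp only [iterate_R] at this; push_cast at this; omega
  exact ⟨n, Or.inr hn⟩

open Classical in
/-- The length of the maximal `L`-run of `W` starting at `c`: the least `n` with `L^n c ∉ W`. [cite: MadrasSlade1993, §3.2 (proof of Theorem 3.2.3)] -/
noncomputable def lrunLen (W : Finset Cell) (c : Cell) : ℕ := Nat.find (exists_iterate_L_notMem W c)

open Classical in
/-- The number of `R`-steps from `c` staying inside `W`: the least `n` with `R^{n+1} c ∉ W`. [cite: MadrasSlade1993, §3.2 (proof of Theorem 3.2.3)] -/
noncomputable def rrunLen (W : Finset Cell) (c : Cell) : ℕ := Nat.find (exists_iterate_R_notMem W c)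

open Classical in
/-- The index at which the `R²`-walk from `c` inside `W` stops (THEOREM-OMEGA §4 (b): «while `R x ∉ W` and `R² x ∈ W`: `x := R² x`»): the least `n` with
`R (R^{2n} c) ∈ W` or `R^{2n+2} c ∉ W`. [cite: MadrasSlade1993, §3.2 (proof of Theorem 3.2.3)] -/
noncomputable def walkIdx (W : Finset Cell) (c : Cell) : ℕ := Nat.find (exists_walkStop W c)

open Classical in
/-- Characterisation of `lrunLen`. [cite: MadrasSlade1993, §3.2 (proof of Theorem 3.2.3)] -/
theorem lrunLen_eq {W : Finset Cell} {c : Cell} {n : ℕ} (hin : ∀ i < n, L^[i] c ∈ W) (hout : L^[n] c ∉ W) : lrunLen W c = n :=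
  (Nat.find_eq_iff _).2 ⟨hout, fun i hi h => h (hin i hi)⟩

open Classical in
/-- Characterisation of `rrunLen`. [cite: MadrasSlade1993, §3.2 (proof of Theorem 3.2.3)] -/
theorem rrunLen_eq {W : Finset Cell} {c : Cell} {n : ℕ} (hin : ∀ i < n, R^[i + 1] c ∈ W) (hout : R^[n + 1] c ∉ W) : rrunLen W c = n :=
  (Nat.find_eq_iff _).2 ⟨hout, fun i hi h => h (hin i hi)⟩

open Classical in
/-- Characterisation of `walkIdx`. [cite: MadrasSlade1993, §3.2 (proof of Theorem 3.2.3)] -/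
theorem walkIdx_eq {W : Finset Cell} {c : Cell} {n : ℕ} (hgo : ∀ i < n, R (R^[2 * i] c) ∉ W ∧ R^[2 * i + 2] c ∈ W)
    (hstop : R (R^[2 * n] c) ∈ W ∨ R^[2 * n + 2] c ∉ W) : walkIdx W c = n :=
  (Nat.find_eq_iff _).2 ⟨hstop, fun i hi h => by
    obtain ⟨h1, h2⟩ := hgo i hi
    rcases h with h | h
    · exact h1 h
    · exact h h2⟩

/-! ### The decoder of CASE 2 -/

open Classical in
/-- ★ **The CASE-2 decoder** `D(W, w)` (THEOREM-OMEGA-g21 §4, readings (a)–(d) restricted to CASE 2, where no recursion is needed): THICK top (`≥ 2`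
contacts): `W − w` if `LR w ∈ W` (class X and the RU flip), else `W` minus the roof run `L w, …` down to but excluding its left end (class R); LEAF top:
the 3-chain below `w` if `#W = 4`, else (RU leaf) `W − w` minus the roof hexagons strictly between `t₀` (end of the `R²`-walk from `LR w`) and `a_k`
(end of the `R`-run from `t₀`). [cite: MadrasSlade1993, §3.2 (proof of Theorem 3.2.3)] -/
noncomputable def decode (W : Finset Cell) (w : Cell) : Finset Cell :=
  if 2 ≤ #(nbrs w ∩ W) then
    (if LR w ∈ W then W.erase w else W \ roof (L^[lrunLen W w - 1] w) (lrunLen W w - 1))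
  else if #W = 4 then {LL (LR w), UR (LL (LR w)), UR (UR (LL (LR w)))}
  else W \ insert w (roof (R^[2 * walkIdx W (LR w)] (LR w)) (rrunLen W (R^[2 * walkIdx W (LR w)] (LR w)) - 1))

/-! ### CASE 2: common tools -/

section Case2

variable {S : Finset Cell} {w : Cell}

/-- Membership in the image in CASE 2. [cite: MadrasSlade1993, §3.2 (proof of Theorem 3.2.3)] -/
theorem mem_omegaImage_iff_of_case2 (hS : IsBrickSet S) (hP : IsPolygon brickWallGraph (bdry S)) (h2 : 2 ≤ #(peel S))
    (hw : IsLexmax (omegaImage S) w) (hwC : w ∈ baseImage (peel S)) {x : Cell} :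
    x ∈ omegaImage S ↔ x ∈ baseImage (peel S) ∨ x ∈ S \ peel S := by
  rw [omegaImage_eq_of_case2 hS hP h2 hw hwC, mem_union]

/-- ★ **The host test**: in CASE 2 a hexagon `q` whose lower-left neighbour cannot be a host of the base (not in the base, or `R`/`UL` of it in the base,
or off the two host rows / too far left on the second row) is not a peeled hexagon. [cite: MadrasSlade1993, §3.2 (proof of Theorem 3.2.3)] -/
theorem notMem_sdiff_of_case2 (hS : IsBrickSet S) (hP : IsPolygon brickWallGraph (bdry S)) (h2 : 2 ≤ #(peel S))
    (hw : IsLexmax (omegaImage S) w) (hwC : w ∈ baseImage (peel S)) {t : Cell} (het : topCell (peel S) = t) {q : Cell}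
    (hq : LL q ∈ peel S → R (LL q) ∉ peel S → UL (LL q) ∉ peel S →
      ¬ (((LL q).2 = t.2 ∧ (LL q).1 ≤ t.1) ∨ ((LL q).2 = t.2 - 1 ∧ t.1 + 3 ≤ (LL q).1))) :
    q ∉ S \ peel S := by
  intro hqS
  have hh := isHost_ll_of_case2 hS hP h2 hw hwC hqS
  have hne : (peel S).Nonempty := card_pos.1 (by omega)
  have ht := isLexmax_topCell hne
  rw [het] at ht
  rcases hh.row_cases (isBrickSet_peel hS) ht with ⟨h1, h2', -⟩ | ⟨h1, h2'⟩
  · exact hq hh.1 hh.2.1 hh.2.2.1 (Or.inl ⟨h1, h2'⟩)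
  · exact hq hh.1 hh.2.1 hh.2.2.1 (Or.inr ⟨h1, h2'⟩)

/-- In CASE 2 nothing of the image lies above or right of `w`. [cite: MadrasSlade1993, §3.2 (proof of Theorem 3.2.3)] -/
theorem notMem_omegaImage_of_above (hw : IsLexmax (omegaImage S) w) {q : Cell} (hq : w.2 < q.2 ∨ (q.2 = w.2 ∧ w.1 < q.1)) :
    q ∉ omegaImage S := by
  rcases hq with h | ⟨h1, h2'⟩
  · exact hw.notMem_of_row_lt h
  · exact hw.notMem_of_right h1 h2'

/-- Two distinct present neighbours make the top thick. [cite: MadrasSlade1993, §3.2 (proof of Theorem 3.2.3)] -/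
theorem two_le_card_contacts {W : Finset Cell} {c d d' : Cell} (hd : d ∈ W) (hdc : d ∈ nbrs c) (hd' : d' ∈ W) (hdc' : d' ∈ nbrs c)
    (hne : d ≠ d') : 2 ≤ #(nbrs c ∩ W) := by
  have hsub : ({d, d'} : Finset Cell) ⊆ nbrs c ∩ W := by
    intro x hx
    rcases mem_insert.1 hx with rfl | hx
    · exact mem_inter.2 ⟨hdc, hd⟩
    · rw [mem_singleton] at hx; subst hx; exact mem_inter.2 ⟨hdc', hd'⟩
  have := card_le_card hsub
  rwa [card_pair hne] at this

/-! ### Class X and the RU flip: the base image is `B + w` -/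

/-- ★ **Shapes X and RU-flip in CASE 2** (`C(B) = B + w` with `LL w, LR w ∈ B`): `S = W − w`, the top is THICK, and `LR w ∈ W`.
[cite: MadrasSlade1993, §3.2 (proof of Theorem 3.2.3)] -/
theorem profile_insert_of_case2 (hS : IsBrickSet S) (hP : IsPolygon brickWallGraph (bdry S)) (h2 : 2 ≤ #(peel S))
    (hw : IsLexmax (omegaImage S) w) (hwC : w ∈ baseImage (peel S)) (hI : baseImage (peel S) = insert w (peel S)) (hwB : w ∉ peel S)
    (hLL : LL w ∈ peel S) (hLR : LR w ∈ peel S) :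
    S = (omegaImage S).erase w ∧ 2 ≤ #(nbrs w ∩ omegaImage S) ∧ LR w ∈ omegaImage S := by
  classical
  have hWeq := omegaImage_eq_of_case2 hS hP h2 hw hwC
  have hdisj := disjoint_baseImage_sdiff_of_case2 hS hP h2 hw hwC
  have hWS : omegaImage S = insert w S := by
    rw [hWeq, hI, insert_union, union_sdiff_of_subset (peel_subset S)]
  have hwS : w ∉ S := fun h => (disjoint_left.1 hdisj) hwC (mem_sdiff.2 ⟨h, hwB⟩)
  refine ⟨by rw [hWS, erase_insert hwS], ?_, ?_⟩
  · have hB : peel S ⊆ omegaImage S := fun x hx => by rw [hWS]; exact mem_insert_of_mem (peel_subset S hx)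
    refine two_le_card_contacts (hB hLL) ?_ (hB hLR) ?_ ?_
    · rw [mem_nbrs_iff]; left; rfl
    · rw [mem_nbrs_iff]; right; left; rfl
    · intro e; have := congrArg Prod.fst e; simp only [LL_fst, LR_fst] at this; omega
  · rw [hWS]; exact mem_insert_of_mem (peel_subset S hLR)

/-! ### Class R: the base image is `B ∪ roof t k` -/

/-- ★ **Shape R in CASE 2** (`L t ∉ B`, `LR t ∈ B`, `w = a_k = roofCell t (k−1)`, `k = runLen B t ≥ 1`): `S = W \ roof t k`, the top is THICK, `LR w ∉ W`,
and the `L`-run of `W` at `w` is `a_k, …, a_1, t` of length `k + 1` (`L t ∉ W`), with `L^k w = t`. [cite: MadrasSlade1993, §3.2 (proof of Theorem 3.2.3)] -/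
theorem profile_roof_of_case2 (hS : IsBrickSet S) (hP : IsPolygon brickWallGraph (bdry S)) (h2 : 2 ≤ #(peel S))
    (hw : IsLexmax (omegaImage S) w) (hwC : w ∈ baseImage (peel S)) {t : Cell} {k : ℕ} (het : topCell (peel S) = t)
    (hek : runLen (peel S) t = k) (hL : L t ∉ peel S) (hk : 1 ≤ k) (hI : baseImage (peel S) = peel S ∪ roof t k)
    (hwt : w = roofCell t (k - 1)) :
    S = omegaImage S \ roof t k ∧ 2 ≤ #(nbrs w ∩ omegaImage S) ∧ LR w ∉ omegaImage S ∧ lrunLen (omegaImage S) w = k + 1 ∧ L^[k] w = t := by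
  classical
  have hne : (peel S).Nonempty := card_pos.1 (by omega)
  have ht : IsLexmax (peel S) t := het ▸ isLexmax_topCell hne
  have hWeq := omegaImage_eq_of_case2 hS hP h2 hw hwC
  have hdisj := disjoint_baseImage_sdiff_of_case2 hS hP h2 hw hwC
  have hmemW : ∀ {x : Cell}, x ∈ omegaImage S ↔ x ∈ baseImage (peel S) ∨ x ∈ S \ peel S := fun {x} => by rw [hWeq, mem_union]
  have hWS : omegaImage S = S ∪ roof t k := by
    rw [hWeq, hI, union_right_comm, union_sdiff_of_subset (peel_subset S)]
  have hdisj' : Disjoint S (roof t k) := by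
    rw [disjoint_left]; intro x hxS hxr
    by_cases hxB : x ∈ peel S
    · exact (disjoint_left.1 (ht.disjoint_roof k)) hxB hxr
    · exact (disjoint_left.1 hdisj) (by rw [hI]; exact mem_union_right _ hxr) (mem_sdiff.2 ⟨hxS, hxB⟩)
  -- coordinates of `w` and of the `L`-iterates of `w`
  have hk1 : ((k - 1 : ℕ) : ℤ) = (k : ℤ) - 1 := by omega
  have hw1 : w.1 = t.1 + 2 * (k : ℤ) := by rw [hwt, roofCell_fst, hk1]; ring
  have hw2 : w.2 = t.2 := by rw [hwt, roofCell_snd]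
  have eL : ∀ i : ℕ, L^[i] w = (t.1 + 2 * (k : ℤ) - 2 * (i : ℤ), t.2) := fun i => by rw [iterate_L, hw1, hw2]
  have hLt : L^[k] w = t := by rw [eL]; ext <;> simp
  have hLin : ∀ i ≤ k, L^[i] w ∈ omegaImage S := by
    intro i hi
    rw [hWS]
    rcases Nat.lt_or_ge i k with hlt | hge
    · refine mem_union_right _ (mem_roof.2 ⟨k - 1 - i, by omega, ?_⟩)
      rw [eL]; ext
      · simp only [roofCell_fst]; omega
      · simp
    · have : i = k := by omega
      subst this
      rw [hLt]; exact mem_union_left _ (peel_subset S ht.1)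
  have hLout : L^[k + 1] w ∉ omegaImage S := by
    have e : L^[k + 1] w = L t := by rw [eL]; ext <;> simp; omega
    rw [e, hmemW, not_or]
    constructor
    · rw [hI, mem_union, not_or]
      refine ⟨hL, fun h => ?_⟩
      obtain ⟨i, -, hi⟩ := mem_roof.1 h
      have := congrArg Prod.fst hi; simp only [roofCell_fst, L_fst] at this; omega
    · refine notMem_sdiff_of_case2 hS hP h2 hw hwC het fun _ _ _ hrows => ?_
      simp only [LL_fst, LL_snd, L_fst, L_snd] at hrows
      omega
  refine ⟨by rw [hWS, union_sdiff_cancel_right hdisj'], ?_, ?_, lrunLen_eq (fun i hi => hLin i (by omega)) hLout, hLt⟩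
  · -- thick: `L w` and `LL w = e_{k-1}`
    have h1 := hLin 1 hk
    rw [Function.iterate_one] at h1
    refine two_le_card_contacts h1 ?_ (d' := LL w) ?_ ?_ ?_
    · rw [mem_nbrs_iff]; right; right; right; right; right; rfl
    · rw [hWS]; refine mem_union_left _ (peel_subset S ?_)
      have e : LL w = runCell t (k - 1) := by ext <;> simp [hw1, hw2, hk1]; ring
      rw [e, ← hek]; exact runCell_mem_of_lt_runLen (by omega)
    · rw [mem_nbrs_iff]; left; rfl
    · intro e; have := congrArg Prod.snd e; simp only [L_snd, LL_snd] at this; omega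
  · -- `LR w = e_k ∉ W`
    rw [hmemW, not_or]
    constructor
    · rw [hI, mem_union, not_or]
      constructor
      · have e : LR w = runCell t k := by ext <;> simp [hw1, hw2]
        rw [e, ← hek]; exact runCell_runLen_notMem (peel S) t
      · intro h
        obtain ⟨i, -, hi⟩ := mem_roof.1 h
        have := congrArg Prod.snd hi; simp only [roofCell_snd, LR_snd] at this; omega
    · refine notMem_sdiff_of_case2 hS hP h2 hw hwC het fun _ _ _ hrows => ?_
      simp only [LL_fst, LL_snd, LR_fst, LR_snd] at hrows
      omega

end Case2

end HexCell

end Literature.Probability.RandomPlanarGeometry.SAW
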